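import Summits.CriticalPhenomena.PercolationContinuityZ3.Theorems.PercNearOneGluingNoHeavyLowerTailSahiCTCC2LevelTwoPrep
import HarnessLib

/-!
# `NoHeavyLowerTail` (crux stmt-CriticalPhenomena-4575), P3 lane: the one-vertex monotonicity C2 IS A CROSSED LUMPED R-FORM of the two section pairs,
# and C2 holds — for every lumped family `D` and every vertex — whenever the pair has no common member inside `D`

Support file (seat `prim-l12-p3`, gen 42; `--supports stmt-CriticalPhenomena-4575`).  Memo
`run/shared/lean/prim/prim-l12/FROM-prim-l12-p3-g42-C2-LEVEL-TWO.md` §4.  For a lumped family `D`, families `𝒳, 𝒵` and a vertex `v` write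
`D⁰, X⁰, Z⁰, C⁰` for the deletions at `v` of `D, 𝒳, 𝒵, 𝒳∩𝒵` and `D¹, X¹, Z¹, C¹` for their links (`…SahiCTCLumpedVertex.delV / linkV`), `Π' = GF(D⁰ of 2^α)`.
The R form of a pair lumped by `D` is `GF(D)·(Π·GF(C∖D) − X·Z) + Π·GF(X∩D)·GF(Z∩D)` (`…SahiCTCLumpedForms.Rlump`).  THIS FILE:
* `RlumpVx_two_sub_three_eq_crossed` (ring identity, ANY `D, 𝒳, 𝒵`): the C2 difference `P₂ − P₃ = RlumpVx D 𝒳 𝒵 v 2 − RlumpVx D 𝒳 𝒵 v 3` equals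
      `GF(D⁰)·(Π'·GF(C¹∖D¹) − X¹Z¹) + GF(D¹)·(Π'·GF(C⁰∖D⁰) − X⁰Z⁰) + GF(D¹)·(X¹−X⁰)(Z¹−Z⁰) + Π'·(GF(X⁰∩D⁰)·GF(Z¹∩D¹) + GF(X¹∩D¹)·GF(Z⁰∩D⁰))`
  — the R forms of the link pair `(X¹,Z¹)` lumped by `D¹` and of the deletion pair `(X⁰,Z⁰)` lumped by `D⁰` with the two lumped weights SWAPPED and the two
  small-world products CROSSED, plus `GF(D¹)·ΔX·ΔZ` ("crossed lumped TP of the sections"; for a pair idle at `v` and `D = {#S < τ+1}` this is the crossed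
  form `V_τ` of memo g41 §4.5b, i.e. g41's "crossed TP" conjecture is the idle slice of C2);
* **`coeff_RlumpVx_two_sub_three_nonneg_of_inter_disjoint`**, **`C2_of_inter_disjoint`** : if `𝒳, 𝒵` are up-sets and NO member of `𝒳 ∩ 𝒵`
  lies in `D` (any family `D`), then all four blocks are `∈ ℕ[s]` (relative Harris forms of `…C2LevelTwoPrep`), so C2 holds at every vertex and every profile — the C2-level
  version of `…SahiCTCLumpedForms.coeff_Rlump_nonneg_of_inter_filter_eq_empty` (which it re-derives through `coeff_Rlump_nonneg_of_C2`: `coeff_Rlump_nonneg_of_inter_disjoint'`).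
Nothing is asserted about the crux; C2 in general (common members inside `D`) is NOT proved here (level `t = 2`: `…SahiCTCC2LevelTwo`).
-/

noncomputable section

open scoped Classical

namespace Summit.CriticalPhenomena.PercolationContinuityZ3.Theorems.SahiCTCForms

open Finset MvPolynomial SahiCTCGenFun

variable {α : Type*} [DecidableEq α] [Fintype α]

variable (D F G : Finset (Finset α)) (v : α)

/-- **C2 is a crossed lumped R-form of the two section pairs** (ring identity, any `D, 𝒳, 𝒵, v`). [this work] -/
theorem RlumpVx_two_sub_three_eq_crossed :
    RlumpVx D F G v 2 - RlumpVx D F G v 3 =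
      gf (delV v D) * (gf (delV v (univ.powerset : Finset (Finset α))) * gf (linkV v ((F ∩ G).filter fun S => S ∉ D))
          - gf (linkV v F) * gf (linkV v G))
      + gf (linkV v D) * (gf (delV v (univ.powerset : Finset (Finset α))) * gf (delV v ((F ∩ G).filter fun S => S ∉ D))
          - gf (delV v F) * gf (delV v G))
      + gf (linkV v D) * ((gf (linkV v F) - gf (delV v F)) * (gf (linkV v G) - gf (delV v G)))
      + gf (delV v (univ.powerset : Finset (Finset α)))
          * (gf (delV v (F.filter fun S => S ∈ D)) * gf (linkV v (G.filter fun S => S ∈ D))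
            + gf (linkV v (F.filter fun S => S ∈ D)) * gf (delV v (G.filter fun S => S ∈ D))) := by
  simp only [RlumpVx]
  ring

variable {D F G}

omit [Fintype α] in
/-- If no member of `𝒳 ∩ 𝒵` lies in `D`, the deletion of `(𝒳∩𝒵)∖D` is `delV 𝒳 ∩ delV 𝒵`. [this work] -/
theorem delV_inter_filter_of_disjoint (h : ∀ S ∈ F ∩ G, S ∉ D) :
    delV v ((F ∩ G).filter fun S => S ∉ D) = delV v F ∩ delV v G := by
  rw [filter_true_of_mem h, delV_inter]

/-- If no member of `𝒳 ∩ 𝒵` lies in `D`, the link of `(𝒳∩𝒵)∖D` is `linkV 𝒳 ∩ linkV 𝒵`. [this work] -/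
theorem linkV_inter_filter_of_disjoint (h : ∀ S ∈ F ∩ G, S ∉ D) :
    linkV v ((F ∩ G).filter fun S => S ∉ D) = linkV v F ∩ linkV v G := by
  rw [filter_true_of_mem h, linkV_inter]

/-- **C2 for pairs without common members in the lumped set**: for any `D`, up-sets `𝒳, 𝒵` with `𝒳 ∩ 𝒵 ∩ D = ∅` and every vertex `v`,
the C2 difference `P₂ − P₃` has nonnegative coefficients. [this work] -/
theorem coeff_RlumpVx_two_sub_three_nonneg_of_inter_disjoint
    (hF : IsUpperSet (F : Set (Finset α))) (hG : IsUpperSet (G : Set (Finset α))) (h : ∀ S ∈ F ∩ G, S ∉ D) (v : α) (m : α →₀ ℕ) :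
    0 ≤ (RlumpVx D F G v 2 - RlumpVx D F G v 3).coeff m := by
  rw [RlumpVx_two_sub_three_eq_crossed, linkV_inter_filter_of_disjoint v h, delV_inter_filter_of_disjoint v h,
    coeff_add, coeff_add, coeff_add]
  have hnn : ∀ K : Finset (Finset α), ∀ n, 0 ≤ (gf K).coeff n := fun K n => coeff_gf_nonneg K n
  have hΔ : ∀ n, 0 ≤ ((gf (linkV v F) - gf (delV v F)) * (gf (linkV v G) - gf (delV v G))).coeff n :=
    coeff_mul_nonneg (coeff_gf_sub_gf_nonneg (delV_subset_linkV_of_isUpperSet hF))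
      (coeff_gf_sub_gf_nonneg (delV_subset_linkV_of_isUpperSet hG))
  refine add_nonneg (add_nonneg (add_nonneg ?_ ?_) ?_) ?_
  · exact coeff_mul_nonneg (hnn _) (coeff_harrisLink_nonneg hF hG) m
  · exact coeff_mul_nonneg (hnn _) (coeff_harrisDel_nonneg hF hG) m
  · exact coeff_mul_nonneg (hnn _) hΔ m
  · refine coeff_mul_nonneg (hnn _) (fun n => ?_) m
    rw [coeff_add]
    exact add_nonneg (coeff_mul_nonneg (hnn _) (hnn _) n) (coeff_mul_nonneg (hnn _) (hnn _) n)

/-- **C2 (one-vertex monotonicity `2 → 3`) holds for every lumped family `D` and every pair of up-sets without common members in `D`.** [this work] -/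
theorem C2_of_inter_disjoint (hF : IsUpperSet (F : Set (Finset α)))
    (hG : IsUpperSet (G : Set (Finset α))) (h : ∀ S ∈ F ∩ G, S ∉ D) (m : α →₀ ℕ) (v : α) (hv : m v = 2) :
    (Rlump D F G).coeff (m + Finsupp.single v 1) ≤ (Rlump D F G).coeff m := by
  set m₀ := m - Finsupp.single v 2 with hm₀
  have hm₀v : m₀ v = 0 := by rw [hm₀, Finsupp.tsub_apply, Finsupp.single_eq_same, hv]
  have hm_eq : m = m₀ + Finsupp.single v 2 := by
    rw [hm₀, tsub_add_cancel_of_le]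
    rw [Finsupp.single_le_iff, hv]
  have h3 : m + Finsupp.single v 1 = m₀ + Finsupp.single v 3 := by
    rw [hm_eq, add_assoc, ← Finsupp.single_add]
  rw [h3, hm_eq, coeff_Rlump_add_single D F G v hm₀v (by norm_num), coeff_Rlump_add_single D F G v hm₀v (by norm_num), ← sub_nonneg,
    ← coeff_sub]
  exact coeff_RlumpVx_two_sub_three_nonneg_of_inter_disjoint hF hG h v m₀

/-- `R_D ∈ ℕ[s]` for pairs without common members in `D`, re-derived through C2 (cf. `coeff_Rlump_nonneg_of_inter_filter_eq_empty`). [this work] -/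
theorem coeff_Rlump_nonneg_of_inter_disjoint' (hD : IsLowerSet (D : Set (Finset α))) (hF : IsUpperSet (F : Set (Finset α)))
    (hG : IsUpperSet (G : Set (Finset α))) (h : ∀ S ∈ F ∩ G, S ∉ D) (m : α →₀ ℕ) : 0 ≤ (Rlump D F G).coeff m :=
  coeff_Rlump_nonneg_of_C2 hD hF hG (fun m v hv => C2_of_inter_disjoint hF hG h m v hv) m

end Summit.CriticalPhenomena.PercolationContinuityZ3.Theorems.SahiCTCForms
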